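import Literature.Geometry.Riemannian.LowEntropyHypersurfacesFourProofs
import Literature.Geometry.Riemannian.ColdingMinicozziEntropyInvariance
import Literature.Geometry.Riemannian.SphericalCylinderEntropy
import Literature.Geometry.Riemannian.SphericalCylinderConformalKernel
import Mathlib
import HarnessLib

/-!
# Ground-state continuity of the conformal push-forward — auxiliary estimates
(stub `stub_groundStateContinuity` of line `conformal-kernel-domination`, crux
`CylinderEntropy.SliceIsolation`, item stmt-SmoothPoincare4-7632; first of two files)

The stub bounds the Euclidean Gaussian areas `F_{y,t}(Φ A)`, `t ≥ t₁ e^{2t₀}`, of the conformal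
image `Φ(A) ⊂ ℝ⁵` (`Φ(x, s) = eˢ x`) of an end-separating cross-section `A` of the cylinder
`N = S⁴ × ℝ ⊂ ℝ⁶` lying in the thin slab `|z₅ − t₀| ≤ η` with area `≤ (1 + ε) 𝓗⁴(S⁴)`, by
`λ(S⁴) + δ`. This file collects the self-contained estimates of that proof:

* **the shadow of a separating set covers the sphere** (`sphere_subset_image_truncL`): the
  1-Lipschitz truncation `π = truncL` maps `A` onto a superset of the unit sphere `S⁴ ⊂ ℝ⁵`
  (a missed point gives a vertical segment in `N ∖ A` joining the two ends; this is the covering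
  step inside the tree's `hausdorffMeasure_sphere_le_of_separatesEnds`, isolated as a lemma);
* **the shadow measure dominates the sphere** (`restrict_sphere_le_map_truncL`):
  `μHE[4]⌊S⁴ ≤ π_#(μHE[4]⌊A)` as measures on `ℝ⁵` (Federer 2.10.11 for the 1-Lipschitz `π` on
  `A ∩ π⁻¹(B)`), hence for every `G ≤ 1`:
  `∫_A G(π z) dμHE[4] ≤ ∫_{S⁴} G dμHE[4] + (μHE[4](A) − μHE[4](S⁴))`
  (`lintegral_le_lintegral_add_sub_of_le`, `setLIntegral_comp_truncL_le`; the separating-set form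
  `helper_shadowEstimate` is the registered helper sub-goal of this file);
* **the Gaussian profile is uniformly Lipschitz at scale `t`**:
  `|e^{-a²/4t} − e^{-b²/4t}| ≤ |a − b| / √(2t)` (`abs_gaussProfile_sub_le`, mean value theorem
  with `(|r|/2t) e^{-r²/4t} ≤ 1/√(2t)` from `v ≤ eᵛ`);
* **heights in a thin slab**: `|z₅ − t₀| ≤ η ⟹ |e^{z₅} − e^{t₀}| ≤ e^{t₀}(e^{η} − 1)`
  (`abs_exp_sub_exp_le_of_abs_sub_le`);
* bookkeeping: the area hypothesis in `μH[4]` transfers to `μHE[4]`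
  (`euclideanHausdorffMeasure_le_of_hausdorffMeasure_le`), `(4πt)⁻² e^{4t₀} ≤ (4πt₁)⁻²` for
  `t ≥ t₁ e^{2t₀}` (`gaussianNormalization_mul_exp_le`, with the tree's `gaussianNormalization_four`), and the
  dilated main term `(4πt)⁻² e^{4t₀} ∫_{S⁴} e^{-‖e^{t₀}x − y‖²/4t} dμHE[4](x) ≤ λ(S⁴)`
  (`gaussianNormalization_mul_setLIntegral_smul_le`, by `F_{y,t}(e^{t₀} S⁴) ≤ λ(e^{t₀} S⁴) = λ(S⁴)`).

Everything is proved; no definition, no named fact, no notation.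

References: H. Federer, *Geometric Measure Theory* (1969), 2.10.11 [Federer1969]; T. H. Colding,
W. P. Minicozzi II, Ann. of Math. 175 (2012), (0.5), (1.8), Lemma 7.2 [ColdingMinicozzi2012].
-/

noncomputable section

-- the registered namespace `Summit.SmoothPoincare4.SmoothPoincare4.Theorems…` repeats a component
set_option linter.dupNamespace false

open MeasureTheory Set Function Filter
open scoped ENNReal NNReal Topology RealInnerProductSpace Pointwise

namespace Summit.SmoothPoincare4.SmoothPoincare4.Theorems.CylinderEntropySliceIsolation

open Literature.Geometry.Riemannian
open Literature.Geometry.Riemannian.SphericalCylinderEntropy (truncL truncL_apply lipschitz_truncL)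
open Literature.Geometry.Riemannian.SphericalCylinderConformal (gaussianNormalization_four)

/-! ## The shadow of a separating set -/

/-- **The shadow of an end-separating set covers the sphere.** If no path in `N ∖ A` joins height
`≤ -R` to height `≥ R`, then every unit vector `q ∈ S⁴ ⊂ ℝ⁵` is the truncation of a point of `A`
(otherwise the vertical segment `{q} × [-(|R|+1), |R|+1] ⊂ N ∖ A` joins the ends). This is the
covering step of the tree's `hausdorffMeasure_sphere_le_of_separatesEnds`. [folklore] -/
theorem sphere_subset_image_truncL {A : Set (EuclideanSpace ℝ (Fin 6))} {R : ℝ}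
    (hR : ∀ a b : EuclideanSpace ℝ (Fin 6), ∑ i : Fin 5, a (Fin.castSucc i) ^ 2 = 1 →
      ∑ i : Fin 5, b (Fin.castSucc i) ^ 2 = 1 → a 5 ≤ -R → R ≤ b 5 →
        ¬ JoinedIn ({z : EuclideanSpace ℝ (Fin 6) | ∑ i : Fin 5, z (Fin.castSucc i) ^ 2 = 1} \ A)
          a b) :
    Metric.sphere (0 : EuclideanSpace ℝ (Fin 5)) 1 ⊆ truncL '' A := by
  -- adapted from `Literature.Geometry.Riemannian.SphericalCylinderEntropy.
  --   hausdorffMeasure_sphere_le_of_separatesEnds` (the `hcover` step)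
  intro q hq
  by_contra hmiss
  have hq1 : ∑ i : Fin 5, q i ^ 2 = 1 := by
    have h1 : ‖q‖ = 1 := mem_sphere_zero_iff_norm.mp hq
    have h2 := EuclideanSpace.norm_sq_eq q
    rw [h1, one_pow] at h2
    simpa [Real.norm_eq_abs, sq_abs] using h2.symm
  let e : ℝ → EuclideanSpace ℝ (Fin 6) := fun h =>
    (EuclideanSpace.equiv (Fin 6) ℝ).symm (Fin.snoc (fun i : Fin 5 => q i) h)
  have he_cast : ∀ h (i : Fin 5), e h (Fin.castSucc i) = q i := by
    intro h i; simp [e]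
  have he_last : ∀ h, e h 5 = h := by
    intro h
    have h1 : Fin.snoc (α := fun _ : Fin 6 => ℝ) (fun i : Fin 5 => q i) h (Fin.last 5) = h :=
      Fin.snoc_last _ _
    simpa [e] using h1
  have hmemN : ∀ h, ∑ i : Fin 5, e h (Fin.castSucc i) ^ 2 = 1 := by
    intro h; simp only [he_cast]; exact hq1
  have hseg : segment ℝ (e (-(|R| + 1))) (e (|R| + 1)) ⊆
      {z : EuclideanSpace ℝ (Fin 6) | ∑ i : Fin 5, z (Fin.castSucc i) ^ 2 = 1} \ A := by
    rintro w ⟨a, b, ha, hb, hab, rfl⟩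
    have hw : ∀ i : Fin 5, (a • e (-(|R| + 1)) + b • e (|R| + 1)) (Fin.castSucc i) = q i := by
      intro i
      simp only [PiLp.add_apply, PiLp.smul_apply, smul_eq_mul, he_cast]
      rw [← add_mul, hab, one_mul]
    refine ⟨by simp only [Set.mem_setOf_eq, hw]; exact hq1, fun hwA => hmiss ⟨_, hwA, ?_⟩⟩
    ext i
    rw [truncL_apply, hw]
  exact hR _ _ (hmemN _) (hmemN _) (by rw [he_last]; linarith [le_abs_self R])
    (by rw [he_last]; linarith [le_abs_self R]) (JoinedIn.of_segment_subset hseg)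

/-- **The shadow measure dominates the sphere**: if `S⁴ ⊆ truncL(A)` then
`μHE[4]⌊S⁴ ≤ truncL_#(μHE[4]⌊A)` as measures on `ℝ⁵` (on a measurable `B`:
`B ∩ S⁴ ⊆ truncL(truncL⁻¹(B) ∩ A)` and the 1-Lipschitz `truncL` does not increase `μHE[4]`,
Federer 2.10.11). [cite: Federer1969, 2.10.11] -/
theorem restrict_sphere_le_map_truncL {A : Set (EuclideanSpace ℝ (Fin 6))}
    (hcov : Metric.sphere (0 : EuclideanSpace ℝ (Fin 5)) 1 ⊆ truncL '' A) :
    (μHE[4] : Measure (EuclideanSpace ℝ (Fin 5))).restrict (Metric.sphere 0 1) ≤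
      ((μHE[4] : Measure (EuclideanSpace ℝ (Fin 6))).restrict A).map truncL := by
  have hmeas : Measurable (truncL : EuclideanSpace ℝ (Fin 6) → EuclideanSpace ℝ (Fin 5)) :=
    truncL.continuous.measurable
  rw [Measure.le_iff]
  intro B hB
  rw [Measure.restrict_apply hB, Measure.map_apply hmeas hB,
    Measure.restrict_apply (hB.preimage hmeas)]
  have hsub : B ∩ Metric.sphere 0 1 ⊆ truncL '' (truncL ⁻¹' B ∩ A) := by
    rintro x ⟨hxB, hxS⟩
    obtain ⟨z, hzA, rfl⟩ := hcov hxS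
    exact ⟨z, ⟨hxB, hzA⟩, rfl⟩
  have hlip : ∀ y ∈ truncL ⁻¹' B ∩ A, ∀ z ∈ truncL ⁻¹' B ∩ A,
      dist (truncL y) (truncL z) ≤ 1 * dist y z := fun y _ z _ => by
    simpa using lipschitz_truncL.dist_le_mul y z
  calc (μHE[4] : Measure (EuclideanSpace ℝ (Fin 5))) (B ∩ Metric.sphere 0 1)
      ≤ (μHE[4] : Measure (EuclideanSpace ℝ (Fin 5))) (truncL '' (truncL ⁻¹' B ∩ A)) :=
        measure_mono hsub
    _ ≤ ENNReal.ofReal (1 ^ 4) * (μHE[4] : Measure (EuclideanSpace ℝ (Fin 6))) (truncL ⁻¹' B ∩ A) :=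
        euclideanHausdorffMeasure_image_le_of_dist_le_mul zero_le_one hlip 4
    _ = (μHE[4] : Measure (EuclideanSpace ℝ (Fin 6))) (truncL ⁻¹' B ∩ A) := by simp

/-- **Decomposition inequality.** If `σ ≤ ν` with `σ` finite, then for every `G ≤ 1`:
`∫ G dν ≤ ∫ G dσ + (ν(univ) − σ(univ))` (write `ν = (ν − σ) + σ` and bound `G` by `1` on the
remainder). [folklore] -/
theorem lintegral_le_lintegral_add_sub_of_le {α : Type*} [MeasurableSpace α] {σ ν : Measure α}
    [IsFiniteMeasure σ] (hle : σ ≤ ν) {G : α → ℝ≥0∞} (hG : ∀ x, G x ≤ 1) :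
    ∫⁻ x, G x ∂ν ≤ ∫⁻ x, G x ∂σ + (ν univ - σ univ) := by
  conv_lhs => rw [← Measure.sub_add_cancel_of_le hle]
  rw [lintegral_add_measure, add_comm]
  gcongr
  calc ∫⁻ x, G x ∂(ν - σ) ≤ ∫⁻ _, 1 ∂(ν - σ) := lintegral_mono hG
    _ = (ν - σ) univ := lintegral_one
    _ = ν univ - σ univ := Measure.sub_apply MeasurableSet.univ hle

/-- **The shadow estimate.** If `S⁴ ⊆ truncL(A)`, then for every measurable `G : ℝ⁵ → [0, 1]`:
`∫_A G(truncL z) dμHE[4](z) ≤ ∫_{S⁴} G dμHE[4] + (μHE[4](A) − μHE[4](S⁴))`. [folklore] -/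
theorem setLIntegral_comp_truncL_le {A : Set (EuclideanSpace ℝ (Fin 6))}
    (hcov : Metric.sphere (0 : EuclideanSpace ℝ (Fin 5)) 1 ⊆ truncL '' A)
    {G : EuclideanSpace ℝ (Fin 5) → ℝ≥0∞} (hGm : Measurable G) (hG : ∀ x, G x ≤ 1) :
    ∫⁻ z in A, G (truncL z) ∂(μHE[4] : Measure (EuclideanSpace ℝ (Fin 6))) ≤
      ∫⁻ x in Metric.sphere (0 : EuclideanSpace ℝ (Fin 5)) 1, G x
          ∂(μHE[4] : Measure (EuclideanSpace ℝ (Fin 5))) +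
        ((μHE[4] : Measure (EuclideanSpace ℝ (Fin 6))) A -
          (μHE[4] : Measure (EuclideanSpace ℝ (Fin 5))) (Metric.sphere 0 1)) := by
  have hmeas : Measurable (truncL : EuclideanSpace ℝ (Fin 6) → EuclideanSpace ℝ (Fin 5)) :=
    truncL.continuous.measurable
  have hV : (μHE[4] : Measure (EuclideanSpace ℝ (Fin 5))) (Metric.sphere 0 1) < ⊤ :=
    Literature.MeasureTheory.Hausdorff.euclideanHausdorffMeasure_sphere_lt_top
      (E := EuclideanSpace ℝ (Fin 5)) finrank_euclideanSpace_fin 1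
  haveI : IsFiniteMeasure ((μHE[4] : Measure (EuclideanSpace ℝ (Fin 5))).restrict
      (Metric.sphere 0 1)) := isFiniteMeasure_restrict.2 hV.ne
  have h := lintegral_le_lintegral_add_sub_of_le (restrict_sphere_le_map_truncL hcov) hG
  rw [lintegral_map hGm hmeas, Measure.map_apply hmeas MeasurableSet.univ, preimage_univ,
    Measure.restrict_apply_univ, Measure.restrict_apply_univ] at h
  exact h

/-! ## The Gaussian profile is uniformly Lipschitz at scale `t` -/

/-- The derivative of the Gaussian profile `r ↦ e^{-r²/4t}`. [folklore] -/
theorem hasDerivAt_gaussProfile (t r : ℝ) :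
    HasDerivAt (fun r : ℝ => Real.exp (-(r ^ 2) / (4 * t)))
      (Real.exp (-(r ^ 2) / (4 * t)) * (-(2 * r) / (4 * t))) r := by
  have h2 : HasDerivAt (fun r : ℝ => r ^ 2) (2 * r) r := by simpa using hasDerivAt_pow 2 r
  have h3 : HasDerivAt (fun r : ℝ => -(r ^ 2)) (-(2 * r)) r := h2.neg
  exact (h3.div_const (4 * t)).exp

/-- **Derivative bound**: `(|r|/2t) e^{-r²/4t} ≤ 1/√(2t)` for `t > 0` (square and use
`v e^{-v} ≤ 1`, `v = r²/2t`). [folklore] -/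
theorem abs_div_mul_exp_le {t : ℝ} (ht : 0 < t) (r : ℝ) :
    |r| / (2 * t) * Real.exp (-(r ^ 2) / (4 * t)) ≤ (Real.sqrt (2 * t))⁻¹ := by
  have hX : 0 ≤ |r| / (2 * t) * Real.exp (-(r ^ 2) / (4 * t)) := by positivity
  have hS : 0 < Real.sqrt (2 * t) := Real.sqrt_pos.2 (by positivity)
  rw [← sq_le_sq₀ hX (inv_nonneg.2 hS.le), inv_pow, Real.sq_sqrt (by positivity : (0:ℝ) ≤ 2 * t),
    mul_pow, ← Real.exp_nat_mul, div_pow, sq_abs]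
  set v := r ^ 2 / (2 * t) with hv
  have hv0 : 0 ≤ v := by positivity
  have h1 : v * Real.exp (-v) ≤ 1 := by
    have h := Real.add_one_le_exp v
    rw [Real.exp_neg, mul_inv_le_iff₀ (Real.exp_pos v)]
    linarith
  have h2 : ((2 : ℕ) : ℝ) * (-(r ^ 2) / (4 * t)) = -v := by
    rw [hv]
    push_cast
    field_simp
    ring
  rw [h2]
  calc r ^ 2 / (2 * t) ^ 2 * Real.exp (-v) = (2 * t)⁻¹ * (v * Real.exp (-v)) := by
        rw [hv]
        field_simp
    _ ≤ (2 * t)⁻¹ * 1 := by gcongr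
    _ = (2 * t)⁻¹ := mul_one _

/-- **The Gaussian profile is `1/√(2t)`-Lipschitz**: `|e^{-a²/4t} − e^{-b²/4t}| ≤ |a − b|/√(2t)`
for `t > 0` (mean value theorem). [folklore] -/
theorem abs_gaussProfile_sub_le {t : ℝ} (ht : 0 < t) (a b : ℝ) :
    |Real.exp (-(a ^ 2) / (4 * t)) - Real.exp (-(b ^ 2) / (4 * t))| ≤
      (Real.sqrt (2 * t))⁻¹ * |a - b| := by
  have hbound : ∀ r ∈ (univ : Set ℝ),
      ‖Real.exp (-(r ^ 2) / (4 * t)) * (-(2 * r) / (4 * t))‖ ≤ (Real.sqrt (2 * t))⁻¹ := by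
    intro r _
    rw [Real.norm_eq_abs, abs_mul, abs_of_pos (Real.exp_pos _), mul_comm]
    have h4 : |-(2 * r) / (4 * t)| = |r| / (2 * t) := by
      rw [abs_div, abs_neg, abs_mul, abs_two, abs_of_pos (by positivity : (0:ℝ) < 4 * t)]
      field_simp
      ring
    rw [h4]
    exact abs_div_mul_exp_le ht r
  have h := Convex.norm_image_sub_le_of_norm_hasDerivWithin_le
    (f := fun r : ℝ => Real.exp (-(r ^ 2) / (4 * t)))
    (fun r _ => (hasDerivAt_gaussProfile t r).hasDerivWithinAt) hbound convex_univ (mem_univ b)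
    (mem_univ a)
  simpa only [Real.norm_eq_abs] using h

/-! ## Heights in a thin slab -/

/-- `|s − t₀| ≤ η ⟹ |eˢ − e^{t₀}| ≤ e^{t₀}(e^{η} − 1)` (the worse side is `s ≥ t₀`; for
`s ≤ t₀` use `1 − e^{-η} ≤ e^{η} − 1`). [folklore] -/
theorem abs_exp_sub_exp_le_of_abs_sub_le {s t₀ η : ℝ} (h : |s - t₀| ≤ η) :
    |Real.exp s - Real.exp t₀| ≤ Real.exp t₀ * (Real.exp η - 1) := by
  obtain ⟨h1, h2⟩ := abs_sub_le_iff.1 h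
  rw [abs_sub_le_iff]
  constructor
  · have h3 : Real.exp s ≤ Real.exp (t₀ + η) := Real.exp_le_exp.2 (by linarith)
    rw [Real.exp_add] at h3
    nlinarith [h3]
  · have h3 : Real.exp (t₀ - η) ≤ Real.exp s := Real.exp_le_exp.2 (by linarith)
    rw [Real.exp_sub] at h3
    have h5 := Real.add_one_le_exp (-η)
    rw [Real.exp_neg] at h5
    have hpos := Real.exp_pos η
    have h6 : Real.exp t₀ / Real.exp η = Real.exp t₀ * (Real.exp η)⁻¹ := div_eq_mul_inv _ _
    have h7 : Real.exp t₀ * (Real.exp η)⁻¹ ≥ Real.exp t₀ * (-η + 1) :=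
      mul_le_mul_of_nonneg_left h5 (Real.exp_pos _).le
    have h8 := Real.add_one_le_exp η
    nlinarith [h3, h6, h7, h8, Real.exp_pos t₀]

/-! ## Bookkeeping: normalisations and the dilated main term -/

/-- The area hypothesis in Mathlib's `μH[4]` transfers verbatim to the normalised `μHE[4]`
(same Haar factor on `ℝ⁵` and `ℝ⁶`). [folklore] -/
theorem euclideanHausdorffMeasure_le_of_hausdorffMeasure_le {A : Set (EuclideanSpace ℝ (Fin 6))}
    {B : Set (EuclideanSpace ℝ (Fin 5))} {C : ℝ≥0∞}
    (h : μH[4] A ≤ C * μH[4] B) :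
    (μHE[4] : Measure (EuclideanSpace ℝ (Fin 6))) A ≤
      C * (μHE[4] : Measure (EuclideanSpace ℝ (Fin 5))) B := by
  rw [Measure.euclideanHausdorffMeasure_def, Measure.euclideanHausdorffMeasure_def,
    Measure.smul_apply, Measure.smul_apply, ENNReal.smul_def, ENNReal.smul_def, smul_eq_mul,
    smul_eq_mul, mul_left_comm]
  exact mul_le_mul' le_rfl (by exact_mod_cast h)

/-- **Scale bookkeeping**: `(4πt)⁻² e^{4t₀} ≤ (4πt₁)⁻²` whenever `t ≥ t₁ e^{2t₀}`, `t₁ > 0`.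
[folklore] -/
theorem sq_inv_mul_exp_le {t₀ t₁ t : ℝ} (ht₁ : 0 < t₁) (ht : t₁ * Real.exp (2 * t₀) ≤ t) :
    ((4 * Real.pi * t) ^ 2)⁻¹ * Real.exp (4 * t₀) ≤ ((4 * Real.pi * t₁) ^ 2)⁻¹ := by
  have h0 : 0 < t₁ * Real.exp (2 * t₀) := by positivity
  have h4 : Real.exp (4 * t₀) = Real.exp (2 * t₀) ^ 2 := by
    rw [← Real.exp_nat_mul]
    ring_nf
  calc ((4 * Real.pi * t) ^ 2)⁻¹ * Real.exp (4 * t₀)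
      ≤ ((4 * Real.pi * (t₁ * Real.exp (2 * t₀))) ^ 2)⁻¹ * Real.exp (4 * t₀) := by
        gcongr
    _ = ((4 * Real.pi * t₁) ^ 2)⁻¹ := by
        rw [h4]
        field_simp

/-- `(4πt)^{-2} · e^{4t₀} ≤ (4πt₁)^{-2}` in `ℝ≥0∞`, for `t ≥ t₁ e^{2t₀}`, `t₁ > 0`. [folklore] -/
theorem gaussianNormalization_mul_exp_le {t₀ t₁ t : ℝ} (ht₁ : 0 < t₁)
    (ht : t₁ * Real.exp (2 * t₀) ≤ t) :
    gaussianNormalization 4 t * ENNReal.ofReal (Real.exp (4 * t₀)) ≤ gaussianNormalization 4 t₁ := by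
  have hpos : 0 < t := lt_of_lt_of_le (by positivity) ht
  rw [gaussianNormalization_four hpos, gaussianNormalization_four ht₁,
    ← ENNReal.ofReal_mul (by positivity)]
  exact ENNReal.ofReal_le_ofReal (sq_inv_mul_exp_le ht₁ ht)

/-- **The dilated main term is a Gaussian area of a round sphere**:
`(4πt)^{-2} e^{4t₀} ∫_{S⁴} e^{-‖e^{t₀}x − y‖²/4t} dμHE[4](x) = F_{y,t}(e^{t₀} S⁴) ≤ λ(e^{t₀} S⁴)
= λ(S⁴)` (change of variables `μHE[4](cE) = c⁴ μHE[4](E)` and dilation invariance of `λ`,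
Colding–Minicozzi 2012, p. 760). [cite: ColdingMinicozzi2012, Lemma 7.2] -/
theorem gaussianNormalization_mul_setLIntegral_smul_le (y : EuclideanSpace ℝ (Fin 5)) {t : ℝ}
    (ht : 0 < t) (t₀ : ℝ) :
    gaussianNormalization 4 t * (ENNReal.ofReal (Real.exp (4 * t₀)) *
      ∫⁻ x in Metric.sphere (0 : EuclideanSpace ℝ (Fin 5)) 1,
        gaussianWeight y t (Real.exp t₀ • x) ∂(μHE[4] : Measure (EuclideanSpace ℝ (Fin 5)))) ≤
      gaussianEntropy 4 (Metric.sphere (0 : EuclideanSpace ℝ (Fin 5)) 1) := by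
  have hc : Real.exp t₀ ≠ 0 := (Real.exp_pos t₀).ne'
  have hcoe : ((‖Real.exp t₀‖₊ : ℝ≥0∞)) ^ 4 = ENNReal.ofReal (Real.exp (4 * t₀)) := by
    rw [show (4 : ℝ) * t₀ = ((4 : ℕ) : ℝ) * t₀ by norm_num, Real.exp_nat_mul,
      ENNReal.ofReal_pow (Real.exp_pos t₀).le, ← enorm_eq_nnnorm, ← ofReal_norm, Real.norm_eq_abs,
      abs_of_pos (Real.exp_pos t₀)]
  rw [← hcoe, ← setLIntegral_smul_set_euclideanHausdorffMeasure hc 4 (gaussianWeight y t),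
    ← gaussianArea_eq, ← gaussianEntropy_smul hc 4 (Metric.sphere (0 : EuclideanSpace ℝ (Fin 5)) 1)]
  exact gaussianArea_le_gaussianEntropy 4 y ht _

/-- **The entropy of the unit `S⁴ ⊂ ℝ⁵` is the finite number `32/(3e²)`.** [cite: ColdingMinicozzi2012, Lemma 7.10] -/
theorem gaussianEntropy_unitSphere_four :
    gaussianEntropy 4 (Metric.sphere (0 : EuclideanSpace ℝ (Fin 5)) 1) =
      ENNReal.ofReal (32 / (3 * Real.exp 1 ^ 2)) :=
  gaussianEntropy_sphere_four 0 one_pos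

/-- `0 < μHE[4](S⁴) < ∞` for the unit sphere of `ℝ⁵`. [folklore] -/
theorem euclideanHausdorffMeasure_unitSphere_four_pos_lt_top :
    0 < (μHE[4] : Measure (EuclideanSpace ℝ (Fin 5))) (Metric.sphere 0 1) ∧
      (μHE[4] : Measure (EuclideanSpace ℝ (Fin 5))) (Metric.sphere 0 1) < ⊤ :=
  ⟨Literature.MeasureTheory.Hausdorff.euclideanHausdorffMeasure_unitSphere_pos
      (E := EuclideanSpace ℝ (Fin 5)) (d := 4) finrank_euclideanSpace_fin (by norm_num),
    Literature.MeasureTheory.Hausdorff.euclideanHausdorffMeasure_sphere_lt_top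
      (E := EuclideanSpace ℝ (Fin 5)) finrank_euclideanSpace_fin 1⟩

/-! ## Registered helper sub-goal -/

/-- **Registered helper sub-goal `helper_shadowEstimate`**: for an end-separating `A ⊆ ℝ⁶` (typed
`JoinedIn` predicate of the route items) and every measurable `G : ℝ⁵ → [0, 1]`,
`∫_A G(truncL z) dμHE⁴ ≤ ∫_{S⁴} G dμHE⁴ + (μHE⁴(A) − μHE⁴(S⁴))` (covering + shadow estimate).
[folklore] -/
theorem helper_shadowEstimate : ∀ (A : Set (EuclideanSpace ℝ (Fin 6)))
    (G : EuclideanSpace ℝ (Fin 5) → ENNReal),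
    (∃ R : ℝ, ∀ a b : EuclideanSpace ℝ (Fin 6), ∑ i : Fin 5, a (Fin.castSucc i) ^ 2 = 1 →
      ∑ i : Fin 5, b (Fin.castSucc i) ^ 2 = 1 → a 5 ≤ -R → R ≤ b 5 →
      ¬ JoinedIn ({z : EuclideanSpace ℝ (Fin 6) | ∑ i : Fin 5, z (Fin.castSucc i) ^ 2 = 1} \ A) a b) →
    Measurable G → (∀ x, G x ≤ 1) →
    ∫⁻ z in A, G (Literature.Geometry.Riemannian.SphericalCylinderEntropy.truncL z) ∂μHE[4] ≤
      ∫⁻ x in Metric.sphere (0 : EuclideanSpace ℝ (Fin 5)) 1, G x ∂μHE[4] +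
        (μHE[4] A - μHE[4] (Metric.sphere (0 : EuclideanSpace ℝ (Fin 5)) 1)) :=
  fun _ _ ⟨_, hR⟩ hGm hG => setLIntegral_comp_truncL_le (sphere_subset_image_truncL hR) hGm hG

end Summit.SmoothPoincare4.SmoothPoincare4.Theorems.CylinderEntropySliceIsolation
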